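import Literature.MathematicalPhysics.QuantumManyBody.JastrowGroundStateEnergy
import Summits.AtomisticToContinuum.BoseEinsteinCondensation.Theses.BECRewardDescent

/-!
# Route `BECRewardDescent`, support item `CondensedTrialState` (stmt-AtomisticToContinuum-12879): helpers

Condensation of the Jastrow (pair-product) trial state `Ψ_φ = ∏_{i<j} Φ(xᵢ - xⱼ)/‖·‖`
(`IsPairProfile.trialState`, the trial state of the in-tree proof of [LSSY2005, Thm. 2.2]) and the
parameter arithmetic, serving `condensedTrialState_proof` in
`BECRewardDescentCondensedTrialState.lean`.

* `le_condensateOccupation_trialState` — **condensation of the Jastrow state**: for a pair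
  profile `φ` with cut-off `b`, `2b < L`, `∫(1 - φ²) ≤ I`, the normalised product state on the torus
  of side `L` has `⟨Ψ_φ, n₀ Ψ_φ⟩ ≥ (1 - (N-1)I/L³) N`. Elementary pointwise argument (no cluster
  expansion): for the slice `Π₀(X; x) = ∏_{l≠0} Φ(x - x_l) ∈ [0,1]` one has `∫_Ω Π₀² ≤ ∫_Ω Π₀` and,
  by the union bound `∏(1-g_l) ≥ 1 - ∑ g_l` with `∫_Ω (1 - Φ(· - z)) ≤ ∫(1-φ²) ≤ I`,
  `∫_Ω Π₀ ≥ L³ - nI` (`n = N - 1`); hence `(L³ - nI) ∫_Ω Π₀² ≤ (∫_Ω Π₀)²`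
  (`slice_sq_lintegral_le`); writing `n₀` through the `0`-th slice
  (`condensateOccupation_succ`, `jastrow_update`) and undoing the slicing
  (`lintegral_cellN_lintegral_update`) gives the bound. This is the crude form
  `depletion ≤ ρ∫(1-f²)` of the Penrose–Onsager depletion of a Jastrow state; its true value
  (`∼ ρ∫(1-f)²`) is not needed.
* `exists_trialState_energy_condensation` — both bounds for `N ≥ 2`: the energy bound is the tree's
  `IsPairProfile.periodicEnergy_trialState_le` (LSSY (2.19)–(2.31) for the trial state itself).
* `jastrow_parameter_bound` — the real arithmetic: with `I = 16πab²`, `K = 16πab`,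
  `E = 8πa/(1-a/b) + 8πaδ`, `a/b ≤ δ ≤ 1/8`, `7δ ≤ η`, `ρ ≤ δ/(256πab²)`, `L³ = N/ρ`, `N ≥ 2`, the
  product-state bound is `≤ 4πaρ(1+η)N`, `(N-1)I < L³`, and `(N-1)I/L³ ≤ η`.

References: LSSY 2005 (arXiv:cond-mat/0610117), Thm. 2.2 and its proof (2.15)–(2.33); Dyson 1957;
Penrose–Onsager 1956, §IV.
-/

noncomputable section

namespace Summit.AtomisticToContinuum.BoseEinsteinCondensation.Theorems

open MeasureTheory Filter Finset
open scoped ENNReal NNReal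
open Literature.MathematicalPhysics.QuantumManyBody.BoseGas

/-! ### Condensation of the Jastrow trial state -/

section Condensation

variable {n : ℕ} {L b : ℝ} {φ : Space → ℝ}

/-- Union bound on the slice product: `1 ≤ Π₀(X; x) + ∑_{l ≠ 0} (1 - Φ(x - x_l))`. [folklore] -/
theorem one_le_sliceProd_add_sum (hφ : IsPairProfile b φ) (X : Config (n + 1)) (x : Space) :
    1 ≤ sliceProd L φ 0 X x + ∑ l ∈ univ.erase 0, (1 - pairFactor L φ (x - X l)) :=
  one_le_prod_add_sum _ _ (fun _ _ => hφ.pairFactor_nonneg _) (fun _ _ => hφ.pairFactor_le_one _)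

/-- `∫_Ω (1 - Φ(x - z)) dx ≤ I = ∫ (1 - φ²)` (since `Φ² ≤ Φ`). [folklore] -/
theorem lintegral_cell_one_sub_pairFactor_le (hφ : IsPairProfile b φ) (hL : 0 < L) (z : Space) :
    ∫⁻ x in cell L, ENNReal.ofReal (1 - pairFactor L φ (x - z)) ≤ profileDefect φ := by
  refine le_trans (lintegral_mono fun x => ENNReal.ofReal_le_ofReal ?_)
    (hφ.lintegral_cell_defect_le hL z)
  have h0 := hφ.pairFactor_nonneg (L := L) (x - z)
  have h1 := hφ.pairFactor_le_one (L := L) (x - z)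
  nlinarith

/-- The slice product is continuous in the free variable. [folklore] -/
theorem continuous_sliceProd (hφ : IsPairProfile b φ) (hL : 0 < L) (hbL : 2 * b < L)
    (X : Config (n + 1)) : Continuous (sliceProd L φ 0 X) := by
  unfold sliceProd
  exact continuous_finsetProd _ fun _ _ =>
    (hφ.contDiff_pairFactor hL hbL).continuous.comp (continuous_id.sub continuous_const)

/-- **Key slice inequality**: `(L³ - nI) ∫_Ω Π₀² ≤ (∫_Ω Π₀)²`, from `Π₀² ≤ Π₀` and
`∫_Ω Π₀ ≥ L³ - nI`. [folklore] -/
theorem slice_sq_lintegral_le (hφ : IsPairProfile b φ) (hL : 0 < L) (hbL : 2 * b < L) {I : ℝ}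
    (hI0 : 0 ≤ I) (hI : profileDefect φ ≤ ENNReal.ofReal I) (X : Config (n + 1)) :
    ENNReal.ofReal (L ^ 3 - n * I) * ∫⁻ x in cell L, ENNReal.ofReal (sliceProd L φ 0 X x ^ 2) ≤
      (∫⁻ x in cell L, ENNReal.ofReal (sliceProd L φ 0 X x)) ^ 2 := by
  set A := ∫⁻ x in cell L, ENNReal.ofReal (sliceProd L φ 0 X x) with hA_def
  set B := ∫⁻ x in cell L, ENNReal.ofReal (sliceProd L φ 0 X x ^ 2) with hB_def
  -- `B ≤ A`
  have hBA : B ≤ A := lintegral_mono fun x => ENNReal.ofReal_le_ofReal (by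
    have h0 := hφ.sliceProd_nonneg (L := L) 0 X x
    have h1 := hφ.sliceProd_le_one (L := L) 0 X x
    nlinarith)
  -- `L³ ≤ A + n I`
  have hmP : Measurable fun x => ENNReal.ofReal (sliceProd L φ 0 X x) :=
    (continuous_sliceProd hφ hL hbL X).measurable.ennreal_ofReal
  have hmg : ∀ l : Fin (n + 1), Measurable fun x : Space =>
      ENNReal.ofReal (1 - pairFactor L φ (x - X l)) := fun l =>
    (continuous_const.sub ((hφ.contDiff_pairFactor hL hbL).continuous.comp
      (continuous_id.sub continuous_const))).measurable.ennreal_ofReal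
  have hcov : ENNReal.ofReal (L ^ 3) ≤ A + n * ENNReal.ofReal I := by
    calc ENNReal.ofReal (L ^ 3) = ∫⁻ _ in cell L, 1 := by
          rw [setLIntegral_one, volume_cell, ENNReal.ofReal_pow hL.le]
      _ ≤ ∫⁻ x in cell L, (ENNReal.ofReal (sliceProd L φ 0 X x) +
            ∑ l ∈ univ.erase 0, ENNReal.ofReal (1 - pairFactor L φ (x - X l))) := by
          refine lintegral_mono fun x => ?_
          have h := one_le_sliceProd_add_sum (L := L) hφ X x
          have hg : ∀ l, 0 ≤ 1 - pairFactor L φ (x - X l) := fun l =>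
            sub_nonneg.mpr (hφ.pairFactor_le_one _)
          calc (1 : ℝ≥0∞) = ENNReal.ofReal 1 := ENNReal.ofReal_one.symm
            _ ≤ ENNReal.ofReal (sliceProd L φ 0 X x +
                  ∑ l ∈ univ.erase 0, (1 - pairFactor L φ (x - X l))) := ENNReal.ofReal_le_ofReal h
            _ = _ := by
                rw [ENNReal.ofReal_add (hφ.sliceProd_nonneg 0 X x) (sum_nonneg fun l _ => hg l),
                  ENNReal.ofReal_sum_of_nonneg fun l _ => hg l]
      _ = A + ∑ l ∈ univ.erase 0, ∫⁻ x in cell L, ENNReal.ofReal (1 - pairFactor L φ (x - X l)) := by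
          rw [lintegral_add_left hmP, lintegral_finsetSum _ fun l _ => hmg l]
      _ ≤ A + ∑ _l ∈ univ.erase (0 : Fin (n + 1)), ENNReal.ofReal I := by
          gcongr with l _
          exact (lintegral_cell_one_sub_pairFactor_le hφ hL (X l)).trans hI
      _ = A + n * ENNReal.ofReal I := by
          rw [sum_const, card_erase_of_mem (mem_univ _), card_univ, Fintype.card_fin, nsmul_eq_mul]
          simp
  -- hence `L³ - nI ≤ A`
  have hA : ENNReal.ofReal (L ^ 3 - n * I) ≤ A := by
    have hnI : (n : ℝ≥0∞) * ENNReal.ofReal I = ENNReal.ofReal (n * I) := by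
      rw [← ENNReal.ofReal_natCast, ← ENNReal.ofReal_mul (Nat.cast_nonneg _)]
    rw [hnI] at hcov
    rcases le_or_gt (L ^ 3) (n * I) with hle | hlt
    · rw [ENNReal.ofReal_of_nonpos (sub_nonpos.mpr hle)]
      exact bot_le
    · have h2 : ENNReal.ofReal (L ^ 3 - n * I) + ENNReal.ofReal (n * I) ≤
          A + ENNReal.ofReal (n * I) := by
        calc ENNReal.ofReal (L ^ 3 - n * I) + ENNReal.ofReal (n * I)
            = ENNReal.ofReal (L ^ 3 - n * I + n * I) :=
              (ENNReal.ofReal_add (sub_nonneg.mpr hlt.le) (by positivity)).symm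
          _ = ENNReal.ofReal (L ^ 3) := by rw [sub_add_cancel]
          _ ≤ _ := hcov
      exact (ENNReal.add_le_add_iff_right ENNReal.ofReal_ne_top).1 h2
  calc ENNReal.ofReal (L ^ 3 - n * I) * B ≤ A * A := mul_le_mul' hA hBA
    _ = A ^ 2 := (sq A).symm

/-- **Condensation of the Jastrow trial state.** For a pair profile `φ` with cut-off `b`,
`2b < L`, and `∫(1 - φ²) ≤ I`, the normalised product state `Ψ_φ = ∏_{i<j} Φ(xᵢ - xⱼ)/‖·‖` on the
torus of side `L` has `⟨Ψ_φ, n₀ Ψ_φ⟩ ≥ (1 - (N-1) I/L³) N` particles in the constant mode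
(`N = n + 1`). Proof: write `n₀` through the `0`-th slice `Ψ_φ(x, X') = Π₀(X'; x) Ψ_{∖0}(X')/‖Ψ‖`
(`condensateOccupation_succ`, `jastrow_update`), apply the slice inequality
`slice_sq_lintegral_le` pointwise in `X'`, and undo the slicing
(`lintegral_cellN_lintegral_update`). [folklore] -/
theorem le_condensateOccupation_trialState (hφ : IsPairProfile b φ) (hL : 0 < L)
    (hbL : 2 * b < L) {I : ℝ} (hI0 : 0 ≤ I) (hI : profileDefect φ ≤ ENNReal.ofReal I)
    (hν : 0 < jastrowNormR L φ (univ : Finset (Fin (n + 1)))) :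
    ENNReal.ofReal ((n + 1) * (1 - n * I / L ^ 3)) ≤
      condensateOccupation (n + 1) L (hφ.trialState hL hbL hν).ψ := by
  classical
  set ν := jastrowNormR L φ (univ : Finset (Fin (n + 1))) with hν_def
  set c : ℝ := (Real.sqrt ν)⁻¹ with hc
  set Ψ := hφ.trialState hL hbL hν with hΨ
  have hψ : ∀ Y, Ψ.ψ Y = ((jastrow L φ univ Y * c : ℝ) : ℂ) := fun Y => rfl
  have hL3 : ENNReal.ofReal L ^ 3 ≠ 0 := pow_ne_zero _ (by simpa using hL)
  have hL3' : ENNReal.ofReal L ^ 3 ≠ ⊤ := ENNReal.pow_ne_top ENNReal.ofReal_ne_top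
  have hL3r : 0 < L ^ 3 := by positivity
  -- Step 1: `n₀` through the `0`-th slice
  have h1 : condensateOccupation (n + 1) L Ψ.ψ = (n + 1 : ℝ≥0∞) * ((ENNReal.ofReal L ^ 3)⁻¹ *
      ((ENNReal.ofReal L ^ 3)⁻¹ * ∫⁻ X in cellN (n + 1) L,
        (‖∫ x in cell L, Ψ.ψ (Function.update X 0 x)‖₊ : ℝ≥0∞) ^ 2)) := by
    rw [condensateOccupation_succ hL, lintegral_sliceMeanSq_zero L Ψ.contDiff.continuous,
      ← mul_assoc (ENNReal.ofReal L ^ 3)⁻¹ (ENNReal.ofReal L ^ 3), ENNReal.inv_mul_cancel hL3 hL3',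
      one_mul]
  -- Step 2: the slice of the product state factorises
  have hslice : ∀ (X : Config (n + 1)) (x : Space), Ψ.ψ (Function.update X 0 x) =
      ((sliceProd L φ 0 X x * (jastrow L φ (univ.erase 0) X * c) : ℝ) : ℂ) := by
    intro X x
    rw [hψ, hφ.jastrow_update hL hbL.le, mul_assoc]
  -- Step 3: the inner integral and its square
  have hcell : volume (cell L) ≠ ⊤ := by
    rw [volume_cell]; exact ENNReal.pow_ne_top ENNReal.ofReal_ne_top
  have hint : ∀ X : Config (n + 1),
      Integrable (sliceProd L φ 0 X) (volume.restrict (cell L)) := fun X =>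
    Measure.integrableOn_of_bounded hcell
      (continuous_sliceProd hφ hL hbL X).measurable.aestronglyMeasurable
      (ae_of_all _ fun x => by
        rw [Real.norm_of_nonneg (hφ.sliceProd_nonneg 0 X x)]
        exact hφ.sliceProd_le_one 0 X x)
  have hsq : ∀ X : Config (n + 1),
      (‖∫ x in cell L, Ψ.ψ (Function.update X 0 x)‖₊ : ℝ≥0∞) ^ 2 =
        (∫⁻ x in cell L, ENNReal.ofReal (sliceProd L φ 0 X x)) ^ 2 *
          ENNReal.ofReal ((jastrow L φ (univ.erase 0) X * c) ^ 2) := by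
    intro X
    simp_rw [hslice X]
    rw [integral_complex_ofReal, integral_mul_const, ennnorm_real_sq, mul_pow,
      ENNReal.ofReal_mul (sq_nonneg _), ENNReal.ofReal_pow
        (setIntegral_nonneg (measurableSet_cell L) fun x _ => hφ.sliceProd_nonneg 0 X x),
      ofReal_integral_eq_lintegral_ofReal (hint X) (ae_of_all _ fun x => hφ.sliceProd_nonneg 0 X x)]
  -- Step 4: the pointwise lower bound through the slice inequality
  have hpt : ∀ X : Config (n + 1),
      ENNReal.ofReal (L ^ 3 - n * I) * ENNReal.ofReal (c ^ 2) *
          ∫⁻ x in cell L, ENNReal.ofReal (jastrow L φ univ (Function.update X 0 x) ^ 2) ≤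
        (‖∫ x in cell L, Ψ.ψ (Function.update X 0 x)‖₊ : ℝ≥0∞) ^ 2 := by
    intro X
    have h2 : ∀ x, ENNReal.ofReal (jastrow L φ univ (Function.update X 0 x) ^ 2) =
        ENNReal.ofReal (sliceProd L φ 0 X x ^ 2) *
          ENNReal.ofReal (jastrow L φ (univ.erase 0) X ^ 2) := fun x => by
      rw [hφ.jastrow_update hL hbL.le, mul_pow, ENNReal.ofReal_mul (sq_nonneg _)]
    simp_rw [h2]
    rw [lintegral_mul_const' _ _ ENNReal.ofReal_ne_top, hsq X, mul_pow,
      ENNReal.ofReal_mul (sq_nonneg _)]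
    calc ENNReal.ofReal (L ^ 3 - n * I) * ENNReal.ofReal (c ^ 2) *
          ((∫⁻ x in cell L, ENNReal.ofReal (sliceProd L φ 0 X x ^ 2)) *
            ENNReal.ofReal (jastrow L φ (univ.erase 0) X ^ 2))
        = (ENNReal.ofReal (L ^ 3 - n * I) *
            ∫⁻ x in cell L, ENNReal.ofReal (sliceProd L φ 0 X x ^ 2)) *
            (ENNReal.ofReal (jastrow L φ (univ.erase 0) X ^ 2) * ENNReal.ofReal (c ^ 2)) := by ring
      _ ≤ (∫⁻ x in cell L, ENNReal.ofReal (sliceProd L φ 0 X x)) ^ 2 *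
            (ENNReal.ofReal (jastrow L φ (univ.erase 0) X ^ 2) * ENNReal.ofReal (c ^ 2)) :=
          mul_le_mul' (slice_sq_lintegral_le hφ hL hbL hI0 hI X) le_rfl
  -- Step 5: integrate over `X` and undo the slicing
  have hS : ENNReal.ofReal (L ^ 3 - n * I) * ENNReal.ofReal L ^ 3 ≤
      ∫⁻ X in cellN (n + 1) L, (‖∫ x in cell L, Ψ.ψ (Function.update X 0 x)‖₊ : ℝ≥0∞) ^ 2 := by
    have hkey := lintegral_cellN_lintegral_update (L := L) (0 : Fin (n + 1))
      (hφ.measurable_jastrow_sq hL hbL univ)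
    have hnorm : ∫⁻ X in cellN (n + 1) L, ENNReal.ofReal (jastrow L φ univ X ^ 2) =
        ENNReal.ofReal ν := by
      rw [← jastrowNormSq, ← hφ.ofReal_jastrowNormR]
    have hcν : ENNReal.ofReal (c ^ 2) * ENNReal.ofReal ν = 1 := by
      rw [← ENNReal.ofReal_mul (sq_nonneg _), hc, inv_pow, Real.sq_sqrt hν.le,
        inv_mul_cancel₀ hν.ne', ENNReal.ofReal_one]
    calc ENNReal.ofReal (L ^ 3 - n * I) * ENNReal.ofReal L ^ 3
        = ENNReal.ofReal (L ^ 3 - n * I) * ENNReal.ofReal (c ^ 2) *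
            (ENNReal.ofReal L ^ 3 * ∫⁻ X in cellN (n + 1) L,
              ENNReal.ofReal (jastrow L φ univ X ^ 2)) := by
          rw [hnorm, mul_comm (ENNReal.ofReal L ^ 3) (ENNReal.ofReal ν), mul_assoc,
            ← mul_assoc (ENNReal.ofReal (c ^ 2)), hcν, one_mul]
      _ = ∫⁻ X in cellN (n + 1) L, ENNReal.ofReal (L ^ 3 - n * I) * ENNReal.ofReal (c ^ 2) *
            ∫⁻ x in cell L, ENNReal.ofReal (jastrow L φ univ (Function.update X 0 x) ^ 2) := by
          rw [← hkey, lintegral_const_mul' _ _ (ENNReal.mul_ne_top ENNReal.ofReal_ne_top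
            ENNReal.ofReal_ne_top)]
      _ ≤ _ := lintegral_mono hpt
  -- Step 6: assemble
  have hfin : ENNReal.ofReal ((n + 1) * (1 - n * I / L ^ 3)) =
      (n + 1 : ℝ≥0∞) * ((ENNReal.ofReal L ^ 3)⁻¹ * ((ENNReal.ofReal L ^ 3)⁻¹ *
          (ENNReal.ofReal (L ^ 3 - n * I) * ENNReal.ofReal L ^ 3))) := by
    rw [mul_comm (ENNReal.ofReal (L ^ 3 - n * I)), ← mul_assoc _ (ENNReal.ofReal L ^ 3),
      ENNReal.inv_mul_cancel hL3 hL3', one_mul, ← ENNReal.ofReal_pow hL.le,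
      ← ENNReal.ofReal_inv_of_pos hL3r, ← ENNReal.ofReal_mul (inv_nonneg.mpr hL3r.le),
      ENNReal.ofReal_mul (by positivity : (0 : ℝ) ≤ n + 1)]
    have hn1 : ENNReal.ofReal ((n : ℝ) + 1) = (n + 1 : ℝ≥0∞) := by
      rw [show ((n : ℝ) + 1) = ((n + 1 : ℕ) : ℝ) by push_cast; ring, ENNReal.ofReal_natCast]
      push_cast
      rfl
    rw [hn1]
    congr 2
    field_simp
  rw [h1, hfin]
  gcongr

/-- **Both bounds for the Jastrow trial state** on `N ≥ 2` particles: the energy bound of the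
printed proof of LSSY Thm. 2.2 for the trial state (`IsPairProfile.periodicEnergy_trialState_le`)
and the condensation bound `le_condensateOccupation_trialState`.
[cite: LSSY2005, Thm. 2.2, proof, (2.19)–(2.31)] -/
theorem exists_trialState_energy_condensation {v : ℝ → ℝ≥0∞} (hv : Measurable v) {N : ℕ}
    (hN : 2 ≤ N) {L b : ℝ} (hL : 0 < L) (hbL : 2 * b < L) {φ : Space → ℝ}
    (hφ : IsPairProfile b φ) {E I K : ℝ} (hE0 : 0 ≤ E) (hI0 : 0 ≤ I) (hK0 : 0 ≤ K)
    (hE : profileEnergy v φ ≤ ENNReal.ofReal E) (hI : profileDefect φ ≤ ENNReal.ofReal I)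
    (hK : profileK φ ≤ ENNReal.ofReal K) (hNI : ((N : ℝ) - 1) * I < L ^ 3) :
    ∃ Ψ : PeriodicTrialState N L,
      periodicEnergy v Ψ ≤ ENNReal.ofReal
        (N * ((N : ℝ) - 1) / 2 * E / (L ^ 3 - ((N : ℝ) - 1) * I) +
          N * ((N : ℝ) - 1) * ((N : ℝ) - 2) * K ^ 2 / (L ^ 3 - ((N : ℝ) - 1) * I) ^ 2) ∧
      ENNReal.ofReal (N * (1 - ((N : ℝ) - 1) * I / L ^ 3)) ≤ condensateOccupation N L Ψ.ψ := by
  obtain ⟨n, rfl⟩ : ∃ n, N = n + 1 := ⟨N - 1, by omega⟩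
  have hν := hφ.jastrowNormR_pos hL hbL hI0 hI hNI (univ : Finset (Fin (n + 1)))
  refine ⟨hφ.trialState hL hbL hν,
    hφ.periodicEnergy_trialState_le hv hN hL hbL hE0 hI0 hK0 hE hI hK hNI hν, ?_⟩
  have h := le_condensateOccupation_trialState hφ hL hbL hI0 hI hν
  convert h using 2
  push_cast
  ring

end Condensation

/-! ### The parameters -/

section Parameters

/-- **The parameter arithmetic.** With `I = 16πab²`, `K = 16πab`, `E = 8πa/(1-a/b) + 8πaδ`,
`a/b ≤ δ ≤ 1/8`, `7δ ≤ η`, `ρ ≤ δ/(256πab²)` and `M = L³ = N/ρ`, `N ≥ 2`: the product-state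
bound is `≤ 4πaρ(1+η)N`, the state is normalisable (`(N-1)I < L³`), and the depletion bound is
`(N-1)I/L³ ≤ η`. [cite: LSSY2005, Thm. 2.2, proof, (2.32)–(2.33)] -/
theorem jastrow_parameter_bound {a b δ η ρ N M : ℝ} (ha : 0 < a) (hb : 0 < b) (hδ : 0 < δ)
    (hδ1 : δ ≤ 1 / 8) (hδη : 7 * δ ≤ η) (hab : a / b ≤ δ) (hρ : 0 < ρ)
    (hρ0 : ρ ≤ δ / (256 * Real.pi * a * b ^ 2)) (hN : 2 ≤ N) (hM : M = N / ρ) :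
    (N - 1) * (16 * Real.pi * a * b ^ 2) < M ∧
    N * (N - 1) / 2 * (8 * Real.pi * a / (1 - a / b) + 8 * Real.pi * a * δ) /
          (M - (N - 1) * (16 * Real.pi * a * b ^ 2)) +
        N * (N - 1) * (N - 2) * (16 * Real.pi * a * b) ^ 2 /
          (M - (N - 1) * (16 * Real.pi * a * b ^ 2)) ^ 2 ≤
      4 * Real.pi * a * ρ * (1 + η) * N ∧
    (1 - η) * N ≤ N * (1 - (N - 1) * (16 * Real.pi * a * b ^ 2) / M) := by
  set I := 16 * Real.pi * a * b ^ 2 with hI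
  set K := 16 * Real.pi * a * b with hK
  set E := 8 * Real.pi * a / (1 - a / b) + 8 * Real.pi * a * δ with hE
  have hπ := Real.pi_pos
  have hπa : 0 < Real.pi * a := mul_pos hπ ha
  have hI0 : 0 < I := by positivity
  have hM0 : 0 < M := by rw [hM]; positivity
  have hN0 : 0 < N := by linarith
  have hNM : N = ρ * M := by rw [hM]; field_simp
  -- `ρ I ≤ δ/16`
  have hρI : ρ * I ≤ δ / 16 := by
    calc ρ * I ≤ δ / (256 * Real.pi * a * b ^ 2) * I :=
          mul_le_mul_of_nonneg_right hρ0 hI0.le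
      _ = δ / 16 := by rw [hI]; field_simp; ring
  -- the denominator `D = M - (N-1) I ≥ M (1 - δ/16) > 0`
  set D := M - (N - 1) * I with hD
  have hD1 : M * (1 - δ / 16) ≤ D := by
    have h1 : (N - 1) * I ≤ N * I := by linarith [hI0.le]
    have h2 : N * I = ρ * I * M := by rw [hNM]; ring
    have h3 : ρ * I * M ≤ δ / 16 * M := mul_le_mul_of_nonneg_right hρI hM0.le
    linarith
  have hD0 : 0 < D := lt_of_lt_of_le (mul_pos hM0 (by linarith)) hD1
  have hD0' : D ≠ 0 := hD0.ne'
  have hND : 0 ≤ (N - 1) / D := div_nonneg (by linarith) hD0.le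
  -- `t = (N-1)/D ≤ ρ (1 + δ)`
  have ht : (N - 1) / D ≤ ρ * (1 + δ) := by
    rw [div_le_iff₀ hD0]
    have h1 : ρ * (1 + δ) * (M * (1 - δ / 16)) ≤ ρ * (1 + δ) * D :=
      mul_le_mul_of_nonneg_left hD1 (by positivity)
    have h2 : N ≤ ρ * (1 + δ) * (M * (1 - δ / 16)) := by
      rw [hNM]
      have : 0 ≤ ρ * M * (δ * (15 - δ)) := by
        have : 0 ≤ δ * (15 - δ) := mul_nonneg hδ.le (by linarith)
        positivity
      linarith
    linarith
  refine ⟨by linarith, ?_, ?_⟩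
  · -- the energy
    have hab1 : a / b < 1 := by linarith
    have hE2 : E / 2 ≤ 4 * Real.pi * a * (1 + 3 * δ) := by
      have h1 : 1 / (1 - a / b) ≤ 1 + 2 * δ := by
        rw [div_le_iff₀ (by linarith)]
        have h5 : 2 * δ * (a / b) ≤ 2 * δ * δ := mul_le_mul_of_nonneg_left hab (by linarith)
        have h6 : 0 ≤ δ * (1 - 2 * δ) := mul_nonneg hδ.le (by linarith)
        linarith
      have h2 : 8 * Real.pi * a / (1 - a / b) ≤ 8 * Real.pi * a * (1 + 2 * δ) := by
        rw [div_eq_mul_one_div]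
        exact mul_le_mul_of_nonneg_left h1 (by positivity)
      rw [hE]
      linarith
    have hE0 : 0 ≤ E / 2 := by
      rw [hE]
      have : 0 ≤ 8 * Real.pi * a / (1 - a / b) := div_nonneg (by positivity) (by linarith)
      positivity
    have hT1 : N * (N - 1) / 2 * E / D ≤ N * (4 * Real.pi * a * (1 + 3 * δ)) * (ρ * (1 + δ)) := by
      have h1 : N * (N - 1) / 2 * E / D = N * (E / 2) * ((N - 1) / D) := by
        field_simp
      rw [h1]
      exact mul_le_mul (mul_le_mul_of_nonneg_left hE2 hN0.le) ht hND (by positivity)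
    have hT2 : N * (N - 1) * (N - 2) * K ^ 2 / D ^ 2 ≤ N * K ^ 2 * (ρ * (1 + δ)) ^ 2 := by
      have h1 : N * (N - 1) * (N - 2) * K ^ 2 / D ^ 2 =
          N * K ^ 2 * ((N - 1) / D * ((N - 2) / D)) := by
        field_simp
      rw [h1]
      have h3 : (N - 2) / D ≤ (N - 1) / D := div_le_div_of_nonneg_right (by linarith) hD0.le
      have h4 : 0 ≤ (N - 2) / D := div_nonneg (by linarith) hD0.le
      have h5 : (N - 1) / D * ((N - 2) / D) ≤ (ρ * (1 + δ)) ^ 2 := by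
        calc (N - 1) / D * ((N - 2) / D) ≤ (N - 1) / D * ((N - 1) / D) :=
              mul_le_mul_of_nonneg_left h3 hND
          _ ≤ ρ * (1 + δ) * (ρ * (1 + δ)) := mul_le_mul ht ht hND (by positivity)
          _ = (ρ * (1 + δ)) ^ 2 := (sq _).symm
      exact mul_le_mul_of_nonneg_left h5 (by positivity)
    have hKρ : K ^ 2 * ρ ≤ Real.pi * a * δ := by
      calc K ^ 2 * ρ ≤ K ^ 2 * (δ / (256 * Real.pi * a * b ^ 2)) :=
            mul_le_mul_of_nonneg_left hρ0 (sq_nonneg _)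
        _ = Real.pi * a * δ := by rw [hK]; field_simp; ring
    have hX : 4 * Real.pi * a * (1 + 3 * δ) * (1 + δ) + K ^ 2 * ρ * (1 + δ) ^ 2 ≤
        4 * Real.pi * a * (1 + η) := by
      have h1 : (1 + δ) ^ 2 ≤ 2 := by nlinarith [mul_nonneg hδ.le (by linarith : (0 : ℝ) ≤ 1 / 8 - δ)]
      have h2 : K ^ 2 * ρ * (1 + δ) ^ 2 ≤ Real.pi * a * δ * 2 :=
        mul_le_mul hKρ h1 (by positivity) (by positivity)
      have h3 : 0 ≤ Real.pi * a * δ * (5 / 2 - 3 * δ) :=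
        mul_nonneg (mul_pos hπa hδ).le (by linarith)
      have h4 : Real.pi * a * (7 * δ) ≤ Real.pi * a * η := mul_le_mul_of_nonneg_left hδη hπa.le
      linarith
    calc N * (N - 1) / 2 * E / D + N * (N - 1) * (N - 2) * K ^ 2 / D ^ 2
        ≤ N * (4 * Real.pi * a * (1 + 3 * δ)) * (ρ * (1 + δ)) + N * K ^ 2 * (ρ * (1 + δ)) ^ 2 :=
          add_le_add hT1 hT2
      _ = N * ρ * (4 * Real.pi * a * (1 + 3 * δ) * (1 + δ) + K ^ 2 * ρ * (1 + δ) ^ 2) := by ring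
      _ ≤ N * ρ * (4 * Real.pi * a * (1 + η)) := mul_le_mul_of_nonneg_left hX (by positivity)
      _ = 4 * Real.pi * a * ρ * (1 + η) * N := by ring
  · -- the depletion
    have h1 : (N - 1) * I / M ≤ η := by
      rw [div_le_iff₀ hM0]
      calc (N - 1) * I ≤ N * I := by linarith [hI0.le]
        _ = ρ * I * M := by rw [hNM]; ring
        _ ≤ δ / 16 * M := mul_le_mul_of_nonneg_right hρI hM0.le
        _ ≤ η * M := mul_le_mul_of_nonneg_right (by linarith) hM0.le
    have h2 := mul_le_mul_of_nonneg_left h1 hN0.le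
    linarith

end Parameters

end Summit.AtomisticToContinuum.BoseEinsteinCondensation.Theorems

end
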